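import Summits.AtomisticToContinuum.Crystallization.Theorems.FrustratedLawDichotomyCellMetric

/-!
# FrustratedLawDichotomy · crux `AperiodicFrustratedLawGap` (stmt-AtomisticToContinuum-27623) — «CellHostTaylor»:
the COHERENT FIRST-ORDER HOST READING (class-A host column of record, edition 3; crit r1856 (B) (L1), cell decomp-a2c, lens-5 g114)

Role.  In the labels-scale master `…CellMasterScale.lb_le_certFloorL_scale` the host column is a label-wise floor
`hhost : ∀ m ∈ M.erase o, host m ≤ φ(‖pos m‖²)` with `φ = phiT` (`V_LJ(r) = φ(r²)`) and `pos m = posL F (a m)`, so that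
`‖pos m‖² = gram (FᵀF) (a m) (a m)` (`…CellMetric.norm_sq_posL`) is LINEAR in the cell metric `G = FᵀF`.  Edition 2 (#99 `…CellF1HostCol`)
reads `host m` as the window minimum of `φ` (shellMin), which costs the full window width label by label (F1: 0.004266 per root at
`ε = 2⁻¹⁰`).  Edition 3 reads `φ` to FIRST ORDER COHERENTLY: with `t⁰_m := gram 1 (a m) (a m) = Σ_i (a m i)²` and the exact increment
`t_m(G) − t⁰_m = gram (G − 1) (a m) (a m)`,
  `Σ_m φ(t_m(G)) ≥ Σ_m φ(t⁰_m) + Σ_ij (G − 1)_ij · S_ij − Σ_m ρ_m⁻⁵ w_m²`,  `S_ij := Σ_m φ′(t⁰_m) · a m i · a m j`  (the WINDOW VIRIAL),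
and over the entrywise metric box `|G_ij − δ_ij| ≤ ε` the linear term is at least `−ε · Σ_ij |S_ij|` (F1: `Σ|S_ij| = 0.2775`, `tr S = −0.0028`;
host cost 0.000136 + 0.000033 per root at `2⁻¹⁰` instead of 0.004266 — census F1WIDTH56).
1. §1 the scalar second-order floor, PURELY ALGEBRAIC (exact identities + monomial bounds, as `…EnergyRemainder` §1):
   ★ `phiT_taylor₂_ge : 0 < ρ ≤ t₀, t₁ ⇒ φ(t₀) + φ′(t₀)(t₁ − t₀) − ρ⁻⁵ (t₁ − t₀)² ≤ φ(t₁)` (and the upper companion with `(7/4)ρ⁻⁸`);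
   window form `phiT_ge_lin_of_window`.  The constant: `φ(t₁) − φ(t₀) − φ′(t₀)Δ = Δ² · ((1/12)C₆ − (1/6)C₃)` with `0 ≤ C₃ ≤ 6ρ⁻⁵`,
   `0 ≤ C₆ ≤ 21ρ⁻⁸`, so `−ρ⁻⁵` is a valid «−½M» (sharper than `−½ sup|φ″|` wherever `φ″ < 0`, i.e. `t > (7/4)^{1/3}`).
2. §2 Gram-form algebra: `gram_sub`, `gram_one_self`, `abs_gram_self_le` (`|gram H v v| ≤ ε (Σ_i |v i|)²` for `|H_ij| ≤ ε`).
3. §3 ★ the label-wise reading `phiT_gram_ge` (ONE interval inequality per label, the shape of (RCU) `bondQF2_le`) and its `posL` form.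
4. §4 ★★ the summed form `sum_phiT_gram_ge` / `sum_phiT_posL_ge`: virial identity `sum_mul_gram_eq` + box minimisation `neg_mul_sum_abs_le`.
5. §5 the K-file literal interface `sum_hostLin_ge_of_readings` / `sum_phiT_posL_ge_of_readings`: per-label READINGS
   `kR m ≤ φ(t⁰_m)` (#99's table), `|dR m − φ′(t⁰_m)| ≤ η` (a `φ′` table), `(t⁰_m − εℓ_m)⁻⁵ (εℓ_m)² ≤ qR m` — all three CLASS-wise
   (functions of `t⁰_m` only: `second_order_le_classwise`, `gram_one_sub_pos` discharge `ℓ_m` by `ℓ ≤ 3t⁰`) — give the literal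
   `Σ kR − ε Σ_ij |Σ_m dR m · a m i · a m j| − ε η Σ_m (Σ_i |a m i|)² − Σ qR ≤ Σ_m host m ≤ Σ_m φ(‖posL F (a m)‖²)`; the K-file folds
   the integer / dyadic sums (`a m = T z m` dyadic, `dR` integer/2³²: `Σ_m dR m a m i a m j = T_i T_j Σ_m d_m z_i z_j / 2³²`) exactly as
   #99 `host_fold`.
Wiring (hand-2, CertF1 column ed-3): `host m := φ(t⁰_m) + φ′(t⁰_m) · gram (FᵀF − 1) (a m) (a m) − qR m` (depends on `F`, which the
master allows: `host` is chosen after `F`), `hhost := phiT_posL_ge hG (a m) (gram_one_sub_pos …) (hq m hm)`, and the host-sum literal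
`hH` by `sum_hostLin_ge_of_readings` (F1 at `ε = 2⁻¹⁰`: first order 0.000136, second order 0.000033 (label-wise `ℓ`) / 0.000074
(class-wise `3t⁰`) per root).

House conventions: SI units · italic scalars, bold vectors, sans-serif tensors · numbered formulae only when referenced · en-dash for
ranges · References = cited works, numbered, alphabetical · no footnotes · British spelling, -ise · Lennard-Jones hyphenated · "folklore"
tags standard calculus / linear algebra; no new references are cited in this file.  No `instance`, no `notation`, no `sorry`.
-/

noncomputable section

namespace Summit.AtomisticToContinuum.Crystallization.Theorems.FrustratedLawDichotomyCellHostTaylor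

open scoped BigOperators
open Summit.AtomisticToContinuum.Crystallization.Theorems.FrustratedLawDichotomyCoherentFloorAlgebra (phiT phiT1)
open Summit.AtomisticToContinuum.Crystallization.Theorems.FrustratedLawDichotomyEnergyRemainder (inv_pow_mul_inv_pow_le)
open Summit.AtomisticToContinuum.Crystallization.Theorems.FrustratedLawDichotomyCellMetric (posL gram norm_sq_posL)

/-! ## §1. The scalar second-order Taylor floor for `φ(t) = t⁻⁶/12 − t⁻³/6` (algebraic: exact identities, monomial bounds) -/

/-- exact second-order identity for `t⁻¹ ^ 3`: the remainder coefficient `C₃ = 3t₀⁻⁴t₁⁻¹ + 2t₀⁻³t₁⁻² + t₀⁻²t₁⁻³`. [folklore] -/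
theorem inv_pow_three_taylor₂ {t₀ t₁ : ℝ} (h₀ : t₀ ≠ 0) (h₁ : t₁ ≠ 0) :
    t₁⁻¹ ^ 3 - t₀⁻¹ ^ 3 + 3 * t₀⁻¹ ^ 4 * (t₁ - t₀)
      = (t₁ - t₀) ^ 2 * (3 * (t₀⁻¹ ^ 4 * t₁⁻¹) + 2 * (t₀⁻¹ ^ 3 * t₁⁻¹ ^ 2) + t₀⁻¹ ^ 2 * t₁⁻¹ ^ 3) := by
  field_simp
  ring

/-- exact second-order identity for `t⁻¹ ^ 6`: coefficient `C₆ = Σ_{j=0}^{5} (6 − j) t₀^{−(7−j)} t₁^{−(j+1)}`. [folklore] -/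
theorem inv_pow_six_taylor₂ {t₀ t₁ : ℝ} (h₀ : t₀ ≠ 0) (h₁ : t₁ ≠ 0) :
    t₁⁻¹ ^ 6 - t₀⁻¹ ^ 6 + 6 * t₀⁻¹ ^ 7 * (t₁ - t₀)
      = (t₁ - t₀) ^ 2 * (6 * (t₀⁻¹ ^ 7 * t₁⁻¹) + 5 * (t₀⁻¹ ^ 6 * t₁⁻¹ ^ 2) + 4 * (t₀⁻¹ ^ 5 * t₁⁻¹ ^ 3)
          + 3 * (t₀⁻¹ ^ 4 * t₁⁻¹ ^ 4) + 2 * (t₀⁻¹ ^ 3 * t₁⁻¹ ^ 5) + t₀⁻¹ ^ 2 * t₁⁻¹ ^ 6) := by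
  field_simp
  ring

/-- bounds for the `t⁻³` coefficient: `0 ≤ C₃ ≤ 6ρ⁻⁵` for `0 < ρ ≤ t₀, t₁`. [folklore] -/
theorem inv_pow_three_coeff₂_mem {ρ t₀ t₁ : ℝ} (hρ : 0 < ρ) (h₀ : ρ ≤ t₀) (h₁ : ρ ≤ t₁) :
    0 ≤ 3 * (t₀⁻¹ ^ 4 * t₁⁻¹) + 2 * (t₀⁻¹ ^ 3 * t₁⁻¹ ^ 2) + t₀⁻¹ ^ 2 * t₁⁻¹ ^ 3
      ∧ 3 * (t₀⁻¹ ^ 4 * t₁⁻¹) + 2 * (t₀⁻¹ ^ 3 * t₁⁻¹ ^ 2) + t₀⁻¹ ^ 2 * t₁⁻¹ ^ 3 ≤ 6 * ρ⁻¹ ^ 5 := by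
  have e1 := inv_pow_mul_inv_pow_le hρ h₀ h₁ 4 1
  have e2 := inv_pow_mul_inv_pow_le hρ h₀ h₁ 3 2
  have e3 := inv_pow_mul_inv_pow_le hρ h₀ h₁ 2 3
  simp only [pow_one] at e1
  constructor <;> nlinarith [e1.1, e1.2, e2.1, e2.2, e3.1, e3.2]

/-- bounds for the `t⁻⁶` coefficient: `0 ≤ C₆ ≤ 21ρ⁻⁸` for `0 < ρ ≤ t₀, t₁`. [folklore] -/
theorem inv_pow_six_coeff₂_mem {ρ t₀ t₁ : ℝ} (hρ : 0 < ρ) (h₀ : ρ ≤ t₀) (h₁ : ρ ≤ t₁) :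
    0 ≤ 6 * (t₀⁻¹ ^ 7 * t₁⁻¹) + 5 * (t₀⁻¹ ^ 6 * t₁⁻¹ ^ 2) + 4 * (t₀⁻¹ ^ 5 * t₁⁻¹ ^ 3)
          + 3 * (t₀⁻¹ ^ 4 * t₁⁻¹ ^ 4) + 2 * (t₀⁻¹ ^ 3 * t₁⁻¹ ^ 5) + t₀⁻¹ ^ 2 * t₁⁻¹ ^ 6
      ∧ 6 * (t₀⁻¹ ^ 7 * t₁⁻¹) + 5 * (t₀⁻¹ ^ 6 * t₁⁻¹ ^ 2) + 4 * (t₀⁻¹ ^ 5 * t₁⁻¹ ^ 3)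
          + 3 * (t₀⁻¹ ^ 4 * t₁⁻¹ ^ 4) + 2 * (t₀⁻¹ ^ 3 * t₁⁻¹ ^ 5) + t₀⁻¹ ^ 2 * t₁⁻¹ ^ 6 ≤ 21 * ρ⁻¹ ^ 8 := by
  have e1 := inv_pow_mul_inv_pow_le hρ h₀ h₁ 7 1
  have e2 := inv_pow_mul_inv_pow_le hρ h₀ h₁ 6 2
  have e3 := inv_pow_mul_inv_pow_le hρ h₀ h₁ 5 3
  have e4 := inv_pow_mul_inv_pow_le hρ h₀ h₁ 4 4
  have e5 := inv_pow_mul_inv_pow_le hρ h₀ h₁ 3 5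
  have e6 := inv_pow_mul_inv_pow_le hρ h₀ h₁ 2 6
  simp only [pow_one] at e1
  constructor <;> nlinarith [e1.1, e1.2, e2.1, e2.2, e3.1, e3.2, e4.1, e4.2, e5.1, e5.2, e6.1, e6.2]

/-- the exact second-order Taylor identity for `φ`: `φ(t₁) − φ(t₀) − φ′(t₀)(t₁ − t₀) = (t₁ − t₀)² · ((1/12)C₆ − (1/6)C₃)`. [folklore] -/
theorem phiT_taylor₂_eq {t₀ t₁ : ℝ} (h₀ : t₀ ≠ 0) (h₁ : t₁ ≠ 0) :
    phiT t₁ - phiT t₀ - phiT1 t₀ * (t₁ - t₀)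
      = (t₁ - t₀) ^ 2 * (1 / 12 * (6 * (t₀⁻¹ ^ 7 * t₁⁻¹) + 5 * (t₀⁻¹ ^ 6 * t₁⁻¹ ^ 2) + 4 * (t₀⁻¹ ^ 5 * t₁⁻¹ ^ 3)
          + 3 * (t₀⁻¹ ^ 4 * t₁⁻¹ ^ 4) + 2 * (t₀⁻¹ ^ 3 * t₁⁻¹ ^ 5) + t₀⁻¹ ^ 2 * t₁⁻¹ ^ 6)
          - 1 / 6 * (3 * (t₀⁻¹ ^ 4 * t₁⁻¹) + 2 * (t₀⁻¹ ^ 3 * t₁⁻¹ ^ 2) + t₀⁻¹ ^ 2 * t₁⁻¹ ^ 3)) := by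
  have i3 := inv_pow_three_taylor₂ h₀ h₁
  have i6 := inv_pow_six_taylor₂ h₀ h₁
  unfold phiT phiT1
  linear_combination (1 / 12 : ℝ) * i6 - (1 / 6 : ℝ) * i3

/-- ★ **scalar second-order floor** (the «one interval inequality per label class», shape of (RCU) `bondQF2_le`): for `0 < ρ ≤ t₀, t₁`,
`φ(t₀) + φ′(t₀)(t₁ − t₀) − ρ⁻⁵ (t₁ − t₀)² ≤ φ(t₁)` — drop `(1/12)C₆ ≥ 0`, bound `(1/6)C₃ ≤ ρ⁻⁵`. [folklore] -/
theorem phiT_taylor₂_ge {ρ t₀ t₁ : ℝ} (hρ : 0 < ρ) (h₀ : ρ ≤ t₀) (h₁ : ρ ≤ t₁) :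
    phiT t₀ + phiT1 t₀ * (t₁ - t₀) - ρ⁻¹ ^ 5 * (t₁ - t₀) ^ 2 ≤ phiT t₁ := by
  have key := phiT_taylor₂_eq (hρ.trans_le h₀).ne' (hρ.trans_le h₁).ne'
  obtain ⟨c3l, c3u⟩ := inv_pow_three_coeff₂_mem hρ h₀ h₁
  obtain ⟨c6l, c6u⟩ := inv_pow_six_coeff₂_mem hρ h₀ h₁
  have hΔ : 0 ≤ (t₁ - t₀) ^ 2 := sq_nonneg _
  nlinarith [mul_nonneg hΔ c6l, mul_le_mul_of_nonneg_left c3u hΔ]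

/-- the upper companion: `φ(t₁) ≤ φ(t₀) + φ′(t₀)(t₁ − t₀) + (7/4)ρ⁻⁸ (t₁ − t₀)²` — drop `(1/6)C₃ ≥ 0`, bound `(1/12)C₆ ≤ (7/4)ρ⁻⁸`.
[folklore] -/
theorem phiT_taylor₂_le {ρ t₀ t₁ : ℝ} (hρ : 0 < ρ) (h₀ : ρ ≤ t₀) (h₁ : ρ ≤ t₁) :
    phiT t₁ ≤ phiT t₀ + phiT1 t₀ * (t₁ - t₀) + 7 / 4 * ρ⁻¹ ^ 8 * (t₁ - t₀) ^ 2 := by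
  have key := phiT_taylor₂_eq (hρ.trans_le h₀).ne' (hρ.trans_le h₁).ne'
  obtain ⟨c3l, c3u⟩ := inv_pow_three_coeff₂_mem hρ h₀ h₁
  obtain ⟨c6l, c6u⟩ := inv_pow_six_coeff₂_mem hρ h₀ h₁
  have hΔ : 0 ≤ (t₁ - t₀) ^ 2 := sq_nonneg _
  nlinarith [mul_nonneg hΔ c3l, mul_le_mul_of_nonneg_left c6u hΔ]

/-- ★ window form: `|t₁ − t₀| ≤ w`, `0 < t₀ − w` ⇒ `φ(t₀) + φ′(t₀)(t₁ − t₀) − (t₀ − w)⁻⁵ w² ≤ φ(t₁)` (`ρ := t₀ − w`). [folklore] -/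
theorem phiT_ge_lin_of_window {t₀ t₁ w : ℝ} (hw : |t₁ - t₀| ≤ w) (hρ : 0 < t₀ - w) :
    phiT t₀ + phiT1 t₀ * (t₁ - t₀) - (t₀ - w)⁻¹ ^ 5 * w ^ 2 ≤ phiT t₁ := by
  have hw' := abs_le.mp hw
  have h₀ : t₀ - w ≤ t₀ := by linarith [abs_nonneg (t₁ - t₀)]
  have h₁ : t₀ - w ≤ t₁ := by linarith [hw'.1]
  have h := phiT_taylor₂_ge hρ h₀ h₁
  have hsq : (t₁ - t₀) ^ 2 ≤ w ^ 2 := by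
    rw [← sq_abs]
    exact pow_le_pow_left₀ (abs_nonneg _) hw 2
  nlinarith [mul_le_mul_of_nonneg_left hsq (pow_nonneg (inv_nonneg.mpr hρ.le) 5)]

/-! ## §2. Gram-form algebra (`…CellMetric.gram G v w = Σ_i Σ_j G_ij · v_i · w_j`) -/

/-- `gram` is additive in the matrix: `gram (G − H) = gram G − gram H`. [folklore] -/
theorem gram_sub (G H : Matrix (Fin 3) (Fin 3) ℝ) (v w : Fin 3 → ℝ) : gram (G - H) v w = gram G v w - gram H v w := by
  simp only [gram, Matrix.sub_apply, sub_mul, Finset.sum_sub_distrib]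

/-- the undeformed reading: `gram 1 v v = Σ_i (v i)²`. [folklore] -/
theorem gram_one_self (v : Fin 3 → ℝ) : gram 1 v v = ∑ i, v i ^ 2 := by
  simp only [gram, Matrix.one_apply, ite_mul, one_mul, zero_mul, Finset.sum_ite_eq, Finset.mem_univ, if_true, pow_two]

/-- an entrywise-small matrix has a small Gram value: `|H_ij| ≤ ε ⇒ |gram H v v| ≤ ε · (Σ_i |v i|)²`. [folklore] -/
theorem abs_gram_self_le {H : Matrix (Fin 3) (Fin 3) ℝ} {ε : ℝ} (hH : ∀ i j, |H i j| ≤ ε) (v : Fin 3 → ℝ) :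
    |gram H v v| ≤ ε * (∑ i, |v i|) ^ 2 := by
  unfold gram
  calc |∑ i, ∑ j, H i j * (v i * v j)| ≤ ∑ i, ∑ j, |H i j * (v i * v j)| :=
        (Finset.abs_sum_le_sum_abs _ _).trans (Finset.sum_le_sum fun i _ => Finset.abs_sum_le_sum_abs _ _)
    _ ≤ ∑ i, ∑ j, ε * (|v i| * |v j|) := by
        refine Finset.sum_le_sum fun i _ => Finset.sum_le_sum fun j _ => ?_
        rw [abs_mul, abs_mul]
        exact mul_le_mul_of_nonneg_right (hH i j) (by positivity)
    _ = ε * (∑ i, |v i|) ^ 2 := by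
        rw [sq, Finset.sum_mul_sum, Finset.mul_sum]
        exact Finset.sum_congr rfl fun i _ => by rw [Finset.mul_sum]

/-- the metric box in the lane's hypothesis shape: `|G_ij − δ_ij| ≤ ε ⇒ |(G − 1)_ij| ≤ ε`. [folklore] -/
theorem abs_sub_one_apply_le {G : Matrix (Fin 3) (Fin 3) ℝ} {ε : ℝ} (hG : ∀ i j, |G i j - (if i = j then 1 else 0)| ≤ ε)
    (i j : Fin 3) : |(G - 1) i j| ≤ ε := by
  rw [Matrix.sub_apply, Matrix.one_apply]
  exact hG i j

/-! ## §3. ★ The label-wise first-order reading (ONE interval inequality per label) -/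

/-- ★ **LABEL-WISE COHERENT HOST READING.**  For a label vector `v` with undeformed reading `t⁰ = gram 1 v v`, `ℓ = (Σ_i |v i|)²` and a
metric `G` in the box `|G_ij − δ_ij| ≤ ε` with `0 < t⁰ − εℓ`:
`φ(t⁰) + φ′(t⁰) · gram (G − 1) v v − (t⁰ − εℓ)⁻⁵ (εℓ)² ≤ φ(gram G v v)`; the middle term is LINEAR in `G`. [folklore] -/
theorem phiT_gram_ge {G : Matrix (Fin 3) (Fin 3) ℝ} {ε : ℝ} (hG : ∀ i j, |G i j - (if i = j then 1 else 0)| ≤ ε) (v : Fin 3 → ℝ)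
    (hρ : 0 < gram 1 v v - ε * (∑ i, |v i|) ^ 2) :
    phiT (gram 1 v v) + phiT1 (gram 1 v v) * gram (G - 1) v v
        - (gram 1 v v - ε * (∑ i, |v i|) ^ 2)⁻¹ ^ 5 * (ε * (∑ i, |v i|) ^ 2) ^ 2 ≤ phiT (gram G v v) := by
  have hΔ : |gram G v v - gram 1 v v| ≤ ε * (∑ i, |v i|) ^ 2 := by
    rw [← gram_sub]
    exact abs_gram_self_le (abs_sub_one_apply_le hG) v
  have h := phiT_ge_lin_of_window hΔ hρ
  rwa [← gram_sub] at h

/-- ★ the same in placed form: `pos = posL F v`, `‖pos‖² = gram (FᵀF) v v` — the `hhost` binder of the labels-scale master with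
`host := φ(t⁰) + φ′(t⁰) · gram (FᵀF − 1) v v − q`. [folklore] -/
theorem phiT_posL_ge {F : Matrix (Fin 3) (Fin 3) ℝ} {ε : ℝ} (hG : ∀ i j, |(F.transpose * F) i j - (if i = j then 1 else 0)| ≤ ε)
    (v : Fin 3 → ℝ) (hρ : 0 < gram 1 v v - ε * (∑ i, |v i|) ^ 2) {q : ℝ}
    (hq : (gram 1 v v - ε * (∑ i, |v i|) ^ 2)⁻¹ ^ 5 * (ε * (∑ i, |v i|) ^ 2) ^ 2 ≤ q) :
    phiT (gram 1 v v) + phiT1 (gram 1 v v) * gram (F.transpose * F - 1) v v - q ≤ phiT (‖posL F v‖ ^ 2) := by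
  rw [norm_sq_posL]
  linarith [phiT_gram_ge hG v hρ]

/-! ## §4. ★★ The summed form: window virial and box minimisation -/

variable {ι : Type*}

/-- VIRIAL IDENTITY: a label sum of weighted Gram values is the pairing of the matrix with the weighted second-moment table
`S_ij = Σ_m c m · a m i · a m j`. [folklore] -/
theorem sum_mul_gram_eq (M : Finset ι) (a : ι → Fin 3 → ℝ) (c : ι → ℝ) (H : Matrix (Fin 3) (Fin 3) ℝ) :
    ∑ m ∈ M, c m * gram H (a m) (a m) = ∑ i, ∑ j, H i j * ∑ m ∈ M, c m * (a m i * a m j) := by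
  simp only [gram, Finset.mul_sum]
  rw [Finset.sum_comm]
  refine Finset.sum_congr rfl fun i _ => ?_
  rw [Finset.sum_comm]
  exact Finset.sum_congr rfl fun j _ => Finset.sum_congr rfl fun m _ => by ring

/-- BOX MINIMISATION: over the entrywise box `|H_ij| ≤ ε` the pairing `Σ_ij H_ij S_ij` is at least `−ε Σ_ij |S_ij|`. [folklore] -/
theorem neg_mul_sum_abs_le {H : Matrix (Fin 3) (Fin 3) ℝ} {ε : ℝ} (hH : ∀ i j, |H i j| ≤ ε) (S : Fin 3 → Fin 3 → ℝ) :
    -(ε * ∑ i, ∑ j, |S i j|) ≤ ∑ i, ∑ j, H i j * S i j := by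
  rw [Finset.mul_sum, ← Finset.sum_neg_distrib]
  refine Finset.sum_le_sum fun i _ => ?_
  rw [Finset.mul_sum, ← Finset.sum_neg_distrib]
  refine Finset.sum_le_sum fun j _ => ?_
  have h1 : |H i j * S i j| ≤ ε * |S i j| := by
    rw [abs_mul]
    exact mul_le_mul_of_nonneg_right (hH i j) (abs_nonneg _)
  linarith [neg_abs_le (H i j * S i j)]

/-- ★★ **SUMMED COHERENT HOST READING** over a finite label set `M` with label vectors `a m`, in the metric box `|G_ij − δ_ij| ≤ ε`:
`Σ_m φ(t⁰_m) − ε Σ_ij |S_ij| − Σ_m (t⁰_m − εℓ_m)⁻⁵ (εℓ_m)² ≤ Σ_m φ(gram G (a m) (a m))`,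
`t⁰_m = gram 1 (a m) (a m)`, `ℓ_m = (Σ_i |a m i|)²`, `S_ij = Σ_m φ′(t⁰_m) a m i a m j`. [folklore] -/
theorem sum_phiT_gram_ge (M : Finset ι) (a : ι → Fin 3 → ℝ) {G : Matrix (Fin 3) (Fin 3) ℝ} {ε : ℝ}
    (hG : ∀ i j, |G i j - (if i = j then 1 else 0)| ≤ ε) (hρ : ∀ m ∈ M, 0 < gram 1 (a m) (a m) - ε * (∑ i, |a m i|) ^ 2) :
    ∑ m ∈ M, phiT (gram 1 (a m) (a m)) - ε * ∑ i, ∑ j, |∑ m ∈ M, phiT1 (gram 1 (a m) (a m)) * (a m i * a m j)|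
        - ∑ m ∈ M, (gram 1 (a m) (a m) - ε * (∑ i, |a m i|) ^ 2)⁻¹ ^ 5 * (ε * (∑ i, |a m i|) ^ 2) ^ 2
      ≤ ∑ m ∈ M, phiT (gram G (a m) (a m)) := by
  have h1 : ∑ m ∈ M, (phiT (gram 1 (a m) (a m)) + phiT1 (gram 1 (a m) (a m)) * gram (G - 1) (a m) (a m)
      - (gram 1 (a m) (a m) - ε * (∑ i, |a m i|) ^ 2)⁻¹ ^ 5 * (ε * (∑ i, |a m i|) ^ 2) ^ 2)
        ≤ ∑ m ∈ M, phiT (gram G (a m) (a m)) :=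
    Finset.sum_le_sum fun m hm => phiT_gram_ge hG (a m) (hρ m hm)
  have h2 : ∑ m ∈ M, phiT1 (gram 1 (a m) (a m)) * gram (G - 1) (a m) (a m)
      = ∑ i, ∑ j, (G - 1) i j * ∑ m ∈ M, phiT1 (gram 1 (a m) (a m)) * (a m i * a m j) :=
    sum_mul_gram_eq M a _ (G - 1)
  have h3 := neg_mul_sum_abs_le (abs_sub_one_apply_le hG) fun i j => ∑ m ∈ M, phiT1 (gram 1 (a m) (a m)) * (a m i * a m j)
  rw [Finset.sum_sub_distrib, Finset.sum_add_distrib, h2] at h1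
  linarith

/-- ★★ the placed form: `G := FᵀF`, `‖posL F (a m)‖² = gram (FᵀF) (a m) (a m)`. [folklore] -/
theorem sum_phiT_posL_ge (M : Finset ι) (a : ι → Fin 3 → ℝ) {F : Matrix (Fin 3) (Fin 3) ℝ} {ε : ℝ}
    (hG : ∀ i j, |(F.transpose * F) i j - (if i = j then 1 else 0)| ≤ ε)
    (hρ : ∀ m ∈ M, 0 < gram 1 (a m) (a m) - ε * (∑ i, |a m i|) ^ 2) :
    ∑ m ∈ M, phiT (gram 1 (a m) (a m)) - ε * ∑ i, ∑ j, |∑ m ∈ M, phiT1 (gram 1 (a m) (a m)) * (a m i * a m j)|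
        - ∑ m ∈ M, (gram 1 (a m) (a m) - ε * (∑ i, |a m i|) ^ 2)⁻¹ ^ 5 * (ε * (∑ i, |a m i|) ^ 2) ^ 2
      ≤ ∑ m ∈ M, phiT (‖posL F (a m)‖ ^ 2) := by
  simp_rw [norm_sq_posL]
  exact sum_phiT_gram_ge M a hG hρ

/-! ## §5. The K-file literal interface: certified READINGS of `φ(t⁰_m)`, `φ′(t⁰_m)` and of the second-order term -/

/-- readings of `φ′` move the virial table by at most `η Σ_m |a m i| |a m j|` per entry. [folklore] -/
theorem abs_virial_sub_le (M : Finset ι) (a : ι → Fin 3 → ℝ) (c d : ι → ℝ) {η : ℝ} (hd : ∀ m ∈ M, |d m - c m| ≤ η)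
    (i j : Fin 3) :
    |∑ m ∈ M, c m * (a m i * a m j)| ≤ |∑ m ∈ M, d m * (a m i * a m j)| + η * ∑ m ∈ M, |a m i| * |a m j| := by
  have hdiff : ∑ m ∈ M, c m * (a m i * a m j) = ∑ m ∈ M, d m * (a m i * a m j) - ∑ m ∈ M, (d m - c m) * (a m i * a m j) := by
    rw [← Finset.sum_sub_distrib]
    exact Finset.sum_congr rfl fun m _ => by ring
  have hrem : |∑ m ∈ M, (d m - c m) * (a m i * a m j)| ≤ η * ∑ m ∈ M, |a m i| * |a m j| := by
    rw [Finset.mul_sum]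
    refine (Finset.abs_sum_le_sum_abs _ _).trans (Finset.sum_le_sum fun m hm => ?_)
    rw [abs_mul, abs_mul]
    exact mul_le_mul_of_nonneg_right (hd m hm) (by positivity)
  rw [hdiff]
  exact (abs_sub _ _).trans (by linarith)

/-- the per-entry correction sums to `η Σ_m (Σ_i |a m i|)²`. [folklore] -/
theorem sum_sum_abs_mul_abs_eq (M : Finset ι) (a : ι → Fin 3 → ℝ) :
    ∑ i, ∑ j, ∑ m ∈ M, |a m i| * |a m j| = ∑ m ∈ M, (∑ i, |a m i|) ^ 2 := by
  symm
  calc ∑ m ∈ M, (∑ i, |a m i|) ^ 2 = ∑ m ∈ M, ∑ i, ∑ j, |a m i| * |a m j| :=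
        Finset.sum_congr rfl fun m _ => by rw [sq, Finset.sum_mul_sum]
    _ = ∑ i, ∑ m ∈ M, ∑ j, |a m i| * |a m j| := Finset.sum_comm
    _ = ∑ i, ∑ j, ∑ m ∈ M, |a m i| * |a m j| := Finset.sum_congr rfl fun i _ => Finset.sum_comm

/-- Cauchy–Schwarz on three coordinates: `ℓ = (Σ_i |v i|)² ≤ 3 · gram 1 v v` — makes the second-order reading CLASS-wise
(`ℓ_m ≤ 3t⁰_m`, so `q` may be read off `t⁰` alone via `second_order_mono`). [folklore] -/
theorem sq_sum_abs_le_three_mul_gram_one (v : Fin 3 → ℝ) : (∑ i, |v i|) ^ 2 ≤ 3 * gram 1 v v := by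
  rw [gram_one_self, Fin.sum_univ_three, Fin.sum_univ_three, ← sq_abs (v 0), ← sq_abs (v 1), ← sq_abs (v 2)]
  nlinarith [sq_nonneg (|v 0| - |v 1|), sq_nonneg (|v 0| - |v 2|), sq_nonneg (|v 1| - |v 2|)]

/-- the second-order term `(t − εℓ)⁻⁵ (εℓ)²` is monotone in `ℓ ∈ [0, ℓ']` while `0 < t − εℓ'` (`0 ≤ ε`). [folklore] -/
theorem second_order_mono {t ε ℓ ℓ' : ℝ} (hε : 0 ≤ ε) (hℓ : 0 ≤ ℓ) (hℓℓ' : ℓ ≤ ℓ') (hρ : 0 < t - ε * ℓ') :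
    (t - ε * ℓ)⁻¹ ^ 5 * (ε * ℓ) ^ 2 ≤ (t - ε * ℓ')⁻¹ ^ 5 * (ε * ℓ') ^ 2 := by
  have hρ' : 0 < t - ε * ℓ := by nlinarith
  have h1 : (t - ε * ℓ)⁻¹ ≤ (t - ε * ℓ')⁻¹ := by
    rw [inv_le_inv₀ hρ' hρ]
    nlinarith
  exact mul_le_mul (pow_le_pow_left₀ (inv_nonneg.mpr hρ'.le) h1 5)
    (pow_le_pow_left₀ (by positivity) (mul_le_mul_of_nonneg_left hℓℓ' hε) 2) (by positivity)
    (pow_nonneg (inv_nonneg.mpr hρ.le) 5)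

/-- the positivity obligation `0 < t⁰ − εℓ` from `0 < t⁰` alone when `3ε < 1` (`ℓ ≤ 3t⁰`). [folklore] -/
theorem gram_one_sub_pos {ε : ℝ} (hε : 0 ≤ ε) (h3ε : 3 * ε < 1) {v : Fin 3 → ℝ} (hv : 0 < gram 1 v v) :
    0 < gram 1 v v - ε * (∑ i, |v i|) ^ 2 := by
  nlinarith [mul_le_mul_of_nonneg_left (sq_sum_abs_le_three_mul_gram_one v) hε]

/-- CLASS-WISE second-order reading: `(t⁰ − εℓ)⁻⁵ (εℓ)² ≤ (t⁰ − 3εt⁰)⁻⁵ (3εt⁰)²` — a function of `t⁰ = gram 1 v v` only, so the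
table `qR` may be indexed by the distance class like `kR`, `dR` (#98/#99). [folklore] -/
theorem second_order_le_classwise {ε : ℝ} (hε : 0 ≤ ε) (h3ε : 3 * ε < 1) {v : Fin 3 → ℝ} (hv : 0 < gram 1 v v) :
    (gram 1 v v - ε * (∑ i, |v i|) ^ 2)⁻¹ ^ 5 * (ε * (∑ i, |v i|) ^ 2) ^ 2
      ≤ (gram 1 v v - ε * (3 * gram 1 v v))⁻¹ ^ 5 * (ε * (3 * gram 1 v v)) ^ 2 :=
  second_order_mono hε (sq_nonneg _) (sq_sum_abs_le_three_mul_gram_one v) (by nlinarith)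

/-- ★ **THE `host` COLUMN OF EDITION 3, summed**: with `host m := φ(t⁰_m) + φ′(t⁰_m) · gram (FᵀF − 1) (a m) (a m) − qR m` (label-wise
`≤ φ(‖posL F (a m)‖²)` by `phiT_posL_ge`), the readings give the literal for the master's `Σ_{m} host m`:
`Σ kR − ε Σ_ij |Σ_m dR m · a m i · a m j| − ε η Σ_m ℓ_m − Σ qR ≤ Σ_m host m` on the metric box. [folklore] -/
theorem sum_hostLin_ge_of_readings (M : Finset ι) (a : ι → Fin 3 → ℝ) {F : Matrix (Fin 3) (Fin 3) ℝ} {ε η : ℝ} (hε : 0 ≤ ε)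
    (hG : ∀ i j, |(F.transpose * F) i j - (if i = j then 1 else 0)| ≤ ε) (kR dR qR : ι → ℝ)
    (hk : ∀ m ∈ M, kR m ≤ phiT (gram 1 (a m) (a m))) (hd : ∀ m ∈ M, |dR m - phiT1 (gram 1 (a m) (a m))| ≤ η) :
    ∑ m ∈ M, kR m - ε * ∑ i, ∑ j, |∑ m ∈ M, dR m * (a m i * a m j)| - ε * η * ∑ m ∈ M, (∑ i, |a m i|) ^ 2 - ∑ m ∈ M, qR m
      ≤ ∑ m ∈ M, (phiT (gram 1 (a m) (a m)) + phiT1 (gram 1 (a m) (a m)) * gram (F.transpose * F - 1) (a m) (a m) - qR m) := by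
  have hk' : ∑ m ∈ M, kR m ≤ ∑ m ∈ M, phiT (gram 1 (a m) (a m)) := Finset.sum_le_sum hk
  have h2 : ∑ m ∈ M, phiT1 (gram 1 (a m) (a m)) * gram (F.transpose * F - 1) (a m) (a m)
      = ∑ i, ∑ j, (F.transpose * F - 1) i j * ∑ m ∈ M, phiT1 (gram 1 (a m) (a m)) * (a m i * a m j) :=
    sum_mul_gram_eq M a _ (F.transpose * F - 1)
  have h3 := neg_mul_sum_abs_le (abs_sub_one_apply_le hG) fun i j => ∑ m ∈ M, phiT1 (gram 1 (a m) (a m)) * (a m i * a m j)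
  have hS : ∑ i, ∑ j, |∑ m ∈ M, phiT1 (gram 1 (a m) (a m)) * (a m i * a m j)|
      ≤ ∑ i, ∑ j, |∑ m ∈ M, dR m * (a m i * a m j)| + η * ∑ m ∈ M, (∑ i, |a m i|) ^ 2 := by
    rw [← sum_sum_abs_mul_abs_eq, Finset.mul_sum, ← Finset.sum_add_distrib]
    refine Finset.sum_le_sum fun i _ => ?_
    rw [Finset.mul_sum, ← Finset.sum_add_distrib]
    exact Finset.sum_le_sum fun j _ => abs_virial_sub_le M a _ dR hd i j
  rw [Finset.sum_sub_distrib, Finset.sum_add_distrib, h2]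
  nlinarith [mul_le_mul_of_nonneg_left hS hε]

/-- ★ **K-FILE INTERFACE (host column, edition 3).**  Per-label READINGS — `kR m ≤ φ(t⁰_m)` (as #99), `|dR m − φ′(t⁰_m)| ≤ η` (a table
of `φ′` readings, certified class-wise like #98), `(t⁰_m − εℓ_m)⁻⁵ (εℓ_m)² ≤ qR m` — give the literal floor of the placed host sum
`Σ kR − ε Σ_ij |Σ_m dR m · a m i · a m j| − ε η Σ_m ℓ_m − Σ qR ≤ Σ_m φ(‖posL F (a m)‖²)` on the metric box `|(FᵀF)_ij − δ_ij| ≤ ε`. [folklore] -/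
theorem sum_phiT_posL_ge_of_readings (M : Finset ι) (a : ι → Fin 3 → ℝ) {F : Matrix (Fin 3) (Fin 3) ℝ} {ε η : ℝ} (hε : 0 ≤ ε)
    (hG : ∀ i j, |(F.transpose * F) i j - (if i = j then 1 else 0)| ≤ ε)
    (hρ : ∀ m ∈ M, 0 < gram 1 (a m) (a m) - ε * (∑ i, |a m i|) ^ 2) (kR dR qR : ι → ℝ)
    (hk : ∀ m ∈ M, kR m ≤ phiT (gram 1 (a m) (a m))) (hd : ∀ m ∈ M, |dR m - phiT1 (gram 1 (a m) (a m))| ≤ η)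
    (hq : ∀ m ∈ M, (gram 1 (a m) (a m) - ε * (∑ i, |a m i|) ^ 2)⁻¹ ^ 5 * (ε * (∑ i, |a m i|) ^ 2) ^ 2 ≤ qR m) :
    ∑ m ∈ M, kR m - ε * ∑ i, ∑ j, |∑ m ∈ M, dR m * (a m i * a m j)| - ε * η * ∑ m ∈ M, (∑ i, |a m i|) ^ 2 - ∑ m ∈ M, qR m
      ≤ ∑ m ∈ M, phiT (‖posL F (a m)‖ ^ 2) := by
  have h0 := sum_phiT_posL_ge M a hG hρ
  have hk' : ∑ m ∈ M, kR m ≤ ∑ m ∈ M, phiT (gram 1 (a m) (a m)) := Finset.sum_le_sum hk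
  have hq' : ∑ m ∈ M, (gram 1 (a m) (a m) - ε * (∑ i, |a m i|) ^ 2)⁻¹ ^ 5 * (ε * (∑ i, |a m i|) ^ 2) ^ 2 ≤ ∑ m ∈ M, qR m :=
    Finset.sum_le_sum hq
  have hS : ∑ i, ∑ j, |∑ m ∈ M, phiT1 (gram 1 (a m) (a m)) * (a m i * a m j)|
      ≤ ∑ i, ∑ j, |∑ m ∈ M, dR m * (a m i * a m j)| + η * ∑ m ∈ M, (∑ i, |a m i|) ^ 2 := by
    rw [← sum_sum_abs_mul_abs_eq, Finset.mul_sum, ← Finset.sum_add_distrib]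
    refine Finset.sum_le_sum fun i _ => ?_
    rw [Finset.mul_sum, ← Finset.sum_add_distrib]
    exact Finset.sum_le_sum fun j _ => abs_virial_sub_le M a _ dR hd i j
  nlinarith [mul_le_mul_of_nonneg_left hS hε]

end Summit.AtomisticToContinuum.Crystallization.Theorems.FrustratedLawDichotomyCellHostTaylor
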